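import Summits.BirchSwinnertonDyer.BirchSwinnertonDyer.Theorems.ManinLocalTwoThreeEulerRemaindersSixtyFour
import Summits.BirchSwinnertonDyer.BirchSwinnertonDyer.Theorems.ManinLocalTwoThreeNewformFortyEight
import Summits.BirchSwinnertonDyer.BirchSwinnertonDyer.Theorems.ManinLocalTwoThreeGaussStableThirtyTwo
import HarnessLib

/-!
# Level 64 (`4 ∣ 64`, genus `g(X₀(64)) = 3`), newform part 1: `φ₆₄ = η(8τ)⁸/(η(4τ)²η(16τ)²)` is killed by both adjoint
# degeneracy maps to level `32` — FACT-FREE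

Cell bsd-f2-manin, route `ManinLocalTwoThree` (crux C2 `ManinOddAtFour`, stmt-22967: `2² ∣ 64`), prover seat p3 gen 23; the
level-`64` twin of p2 g26's `…NewformFortyEight` (same architecture, `24 ↦ 32`, `48 ↦ 64`):
`S₂(Γ₀(64)) = ℂφ₃₂ ⊕ ℂφ₃₂|diag(2,1) ⊕ ℂφ₆₄` and the newform has to be separated from the old forms.

* §1 `φ₆₄ = η₈⁸/(η₄²η₁₆²) = q + 2q⁵ − 3q⁹ − 6q¹³ + ⋯ ∈ S₂(Γ₀(64))` (Ligozat certificate), `a₁(φ₆₄) = 1`.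
* §2 `U₂ φ₆₄ = 0` (`φ₆₄` is `q` times a series in `q⁴`; the half-shift negates it, p2's `etaQuotientC_add_half`), i.e. the
  adjoint degeneracy map `S₂(Γ₀(64)) → S₂(Γ₀(32))` at `d = 2` kills `φ₆₄` (tree `coe_adjDegeneracyMap0_of_sq_dvd`).
* §3 The trace `S₂(Γ₀(64)) → S₂(Γ₀(32))` (adjoint degeneracy map at `d = 1`, tree `coe_adjDegeneracyMap0_one_eq_sum`:
  `φ ↦ φ + φ|W`, `W = ᵀ(T³²) = (1 0; 32 1)`) kills `φ₆₄`: `φ₆₄ = u·φ₃₂` with the weight-`0` level-`32` quotient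
  `u = η₈⁶/(η₄⁴η₁₆²)`; Dedekind's functional equation factor by factor (tree `etaQuotient_smul_eq_cexp_sum_rademacherPhi`,
  `Φ(1,0;c,1) = 3 − c` from the Dedekind sums `s(1,c)`, `c ∣ 32`) gives the law `g(Wτ) = e^{−(πi/12)Σ(32/δ)r_δ} g(τ)` for
  weight-`0` `η`-quotients of level `32`, so `u∘W = −u` (`Σ(32/δ)r_δ = −12`), `φ₆₄(Wτ) = −(32τ+1)²φ₆₄(τ)`, `φ₆₄|W = −φ₆₄`,
  `φ₆₄ + φ₆₄|W = 0`.

The sequel `…NewformPinningSixtyFour` concludes: `φ₆₄` is new, `S₂(Γ₀(64))^{new} = ℂφ₆₄`, `D.f = φ₆₄` for every `X₀(64)`-datum,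
whence (with `…NeronSqueezeSixtyFour`) `|c| = 1` on `X₀(64)` UNCONDITIONALLY.  No definition (the form is carried as `φ` with
`⇑φ = etaQuotient 64 …`), no named fact, no sorry.  Nothing here proves C2, Manin's conjecture or BSD.
[cite: Ligozat1975, Ch. 3] [cite: AtkinLehner1970, Lemma 7, Thm. 5] [cite: DiamondShurman2005, §5.1] [cite: Apostol1990, Thm. 3.4]
[cite: RademacherGrosswald1972, Ch. 4 A] [cite: MartinOno1997, Thm. 2]
-/

set_option autoImplicit false
-- lint-debt: the directory name repeats the summit name (sibling precedent `ManinLocalTwoThreeNewformFortyEight.lean`)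
set_option linter.dupNamespace false

noncomputable section

open Complex Filter Topology Set Function Asymptotics
open UpperHalfPlane hiding I
open scoped Real Topology Manifold MatrixGroups ModularForm
open ModularForm CongruenceSubgroup Matrix.SpecialLinearGroup
open Literature.NumberTheory.ModularForms
open Literature.NumberTheory.EllipticCurves Literature.NumberTheory.EllipticCurves.ModularForms

namespace Summit.BirchSwinnertonDyer.BirchSwinnertonDyer.Theorems.ManinLocalTwoThree.NewformSixtyFour

open CuspToolkit QRemainder EulerRemainders EulerRemaindersThirtyTwo EulerRemaindersSixtyFour
open NewformFortyEight (etaQuotientC_add_half slash_mapGL)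

/-! ## §1 `φ₆₄ = η₈⁸/(η₄²η₁₆²) ∈ S₂(Γ₀(64))` -/

/-- Ligozat/Newman certificate of `φ₆₄` (`Σδr = Σ(64/δ)r = 24`, `∏δ^{|r|} = 2³⁶ = 262144²`, positive order at all `12` cusps).
[cite: Ligozat1975, Ch. 3] -/
theorem etaCert_sixtyFour : EtaCert 64 [(4, -2), (8, 8), (16, -2)] 262144 := by
  decide

/-- Newman's conditions for `φ₆₄` in weight `2`. [folklore] -/
theorem newmanCond_phi64' : NewmanCond 64 (expFn [(4, -2), (8, 8), (16, -2)]) 2 :=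
  newmanCond_of_etaCert etaCert_sixtyFour

/-- **`φ₆₄` is a weight-`2` cusp form on `Γ₀(64)`** (as a term: `etaQuotientCuspForm`). [cite: Ligozat1975, Ch. 3] -/
theorem exists_cuspForm_phi64 :
    ∃ φ : CuspForm (Gamma0 64) 2, ⇑φ = etaQuotient 64 (expFn [(4, -2), (8, 8), (16, -2)]) :=
  ⟨etaQuotientCuspForm 64 _ 2 (by decide) newmanCond_phi64' etaCert_sixtyFour.2.2.2.2, rfl⟩

/-- `φ₆₄/q → 1` at `i∞`. [folklore] -/
theorem tendsto_phi64_div_qParam :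
    Tendsto (fun τ : ℍ ↦ etaQuotient 64 (expFn [(4, -2), (8, 8), (16, -2)]) τ / Periodic.qParam 1 (τ : ℂ))
      atImInfty (𝓝 1) := by
  have h := tendsto_etaQuotient_div_qParam_zpow 64 (expFn [(4, -2), (8, 8), (16, -2)]) 1 (by decide)
  simpa only [zpow_one] using h

/-- `φ₆₄ ≠ 0` and `a₁(φ₆₄) = 1`, for any cusp form `φ` on `Γ₀(64)` whose function is `η₈⁸/(η₄²η₁₆²)`. [cite: MartinOno1997, Thm. 2] -/
theorem phi64_ne_zero_and_cuspCoeff_one (φ : CuspForm (Gamma0 64) 2)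
    (hφ : ⇑φ = etaQuotient 64 (expFn [(4, -2), (8, 8), (16, -2)])) : φ ≠ 0 ∧ cuspCoeff φ 1 = 1 := by
  refine ⟨fun h ↦ ?_, NonVacuityTwentySeven.cuspCoeff_one_eq_of_tendsto _ (by simpa only [hφ] using tendsto_phi64_div_qParam)⟩
  have h1 := congrArg (fun f : CuspForm (Gamma0 64) 2 ↦ f UpperHalfPlane.I) h
  simp only [CuspForm.zero_apply] at h1
  rw [hφ] at h1
  exact etaQuotient_ne_zero 64 _ _ h1


/-! ## §2 `U₂ φ₆₄ = 0`: the half-shift negates `φ₆₄` -/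

/-- **`φ₆₄(z + ½) = −φ₆₄(z)`** (`δ ∈ {4, 8, 16}` all even, `Σ_δ (δ/2) r_δ = −4 + 32 − 16 = 12`). [cite: Koehler2011, §1] -/
theorem etaQuotientC_phi64_add_half (z : ℂ) :
    etaQuotientC 64 (expFn [(4, -2), (8, 8), (16, -2)]) (z + 1 / 2)
      = -etaQuotientC 64 (expFn [(4, -2), (8, 8), (16, -2)]) z := by
  rw [etaQuotientC_add_half 64 _ (by decide) z]
  have hs : (∑ t ∈ Nat.divisors 64, ((t / 2 : ℕ) : ℤ) * expFn [(4, -2), (8, 8), (16, -2)] t : ℤ) = 12 := by decide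
  rw [hs, show (2 * π * I * ((12 : ℤ) : ℂ) / 24 : ℂ) = π * I by push_cast; ring, Complex.exp_pi_mul_I]
  ring

/-- **`U₂ φ₆₄ = 0`**, i.e. the adjoint degeneracy map `S₂(Γ₀(64)) → S₂(Γ₀(32))` at `d = 2` kills `φ₆₄`
(`= ½(φ₆₄(τ/2) + φ₆₄((τ+1)/2)) = 0`). [cite: AtkinLehner1970, Lemma 7] -/
theorem adjDegeneracyMap0_two_phi64 (φ : CuspForm (Gamma0 64) 2)
    (hφ : ⇑φ = etaQuotient 64 (expFn [(4, -2), (8, 8), (16, -2)])) :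
    adjDegeneracyMap0 64 32 2 2 φ = 0 := by
  haveI : Fact (Nat.Prime 2) := ⟨Nat.prime_two⟩
  have h := coe_adjDegeneracyMap0_of_sq_dvd (N := 64) (k := 2) Nat.prime_two (by norm_num) φ
  apply DFunLike.ext
  intro τ
  have hτ := congr_fun h τ
  rw [coe_heckeT_gamma0_eq_sum 64 2 2 Nat.prime_two φ, if_pos (by norm_num), add_zero, Finset.sum_apply,
    Fin.sum_univ_two, slash_tpB_apply, slash_tpB_apply, hφ] at hτ
  rw [CuspForm.zero_apply]
  refine hτ.trans ?_
  rw [etaQuotient, etaQuotient, coe_tpB_smul, coe_tpB_smul]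
  have h1 : (((τ : ℂ) + ((((1 : Fin 2) : ℕ) : ℤ) : ℂ)) / ((2 : ℕ) : ℂ)) = (τ : ℂ) / 2 + 1 / 2 := by
    simp only [Fin.val_one, Nat.cast_one, Int.cast_one, Nat.cast_ofNat]; ring
  have h0 : (((τ : ℂ) + ((((0 : Fin 2) : ℕ) : ℤ) : ℂ)) / ((2 : ℕ) : ℂ)) = (τ : ℂ) / 2 := by
    simp only [Fin.val_zero, Nat.cast_zero, Int.cast_zero, Nat.cast_ofNat]; ring
  rw [h1, h0, etaQuotientC_phi64_add_half]
  ring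

/-! ## §3 The trace to level `32` kills `φ₆₄`: Dedekind sums and the `W = (1 0; 32 1)`-symmetry -/

/-- `s(1,1) = s(1,2) = 0`, `s(1,4) = 1/8`, `s(1,8) = 7/16`, `s(1,16) = 35/32`, `s(1,32) = 155/64` (`s(1,k) = (k−1)(k−2)/(12k)`).
[cite: RademacherGrosswald1972, Ch. 1 eq. (1)] -/
theorem dedekindSum_one_values32 :
    dedekindSum 1 1 = 0 ∧ dedekindSum 1 2 = 0 ∧ dedekindSum 1 4 = 1 / 8 ∧ dedekindSum 1 8 = 7 / 16 ∧
      dedekindSum 1 16 = 35 / 32 ∧ dedekindSum 1 32 = 155 / 64 := by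
  refine ⟨?_, ?_, ?_, ?_, ?_, ?_⟩ <;>
  · rw [dedekindSum_def]
    simp only [Finset.sum_range_succ, Finset.sum_range_zero]
    norm_num [dedekindSaw]

/-- `Φ(1, 0; c, 1) = 3 − c` for `c ∈ {1, 2, 4, 8, 16, 32}` (the divisors of `32`). [cite: RademacherGrosswald1972, Ch. 4 A, eq. (59)] -/
theorem rademacherPhi_lower_values32 :
    rademacherPhi 1 0 1 1 = 2 ∧ rademacherPhi 1 0 2 1 = 1 ∧ rademacherPhi 1 0 4 1 = -1 ∧
      rademacherPhi 1 0 8 1 = -5 ∧ rademacherPhi 1 0 16 1 = -13 ∧ rademacherPhi 1 0 32 1 = -29 := by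
  obtain ⟨h1, h2, h4, h8, h16, h32⟩ := dedekindSum_one_values32
  refine ⟨?_, ?_, ?_, ?_, ?_, ?_⟩
  · rw [rademacherPhi_of_c_ne_zero (by norm_num), Int.sign_eq_one_of_pos (by norm_num),
      show (1 : ℤ).natAbs = 1 from rfl, h1]; norm_num
  · rw [rademacherPhi_of_c_ne_zero (by norm_num), Int.sign_eq_one_of_pos (by norm_num),
      show (2 : ℤ).natAbs = 2 from rfl, h2]; norm_num
  · rw [rademacherPhi_of_c_ne_zero (by norm_num), Int.sign_eq_one_of_pos (by norm_num),
      show (4 : ℤ).natAbs = 4 from rfl, h4]; norm_num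
  · rw [rademacherPhi_of_c_ne_zero (by norm_num), Int.sign_eq_one_of_pos (by norm_num),
      show (8 : ℤ).natAbs = 8 from rfl, h8]; norm_num
  · rw [rademacherPhi_of_c_ne_zero (by norm_num), Int.sign_eq_one_of_pos (by norm_num),
      show (16 : ℤ).natAbs = 16 from rfl, h16]; norm_num
  · rw [rademacherPhi_of_c_ne_zero (by norm_num), Int.sign_eq_one_of_pos (by norm_num),
      show (32 : ℤ).natAbs = 32 from rfl, h32]; norm_num

/-- **Transformation of a weight-`0` `η`-quotient of level `32` under `W = (1 0; 32 1)`**: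
`g(Wτ) = exp(−(πi/12) Σ_δ (32/δ) r_δ) · g(τ)` — Dedekind's functional equation factor by factor
(tree `etaQuotient_smul_eq_cexp_sum_rademacherPhi`) with `Φ(1, 0; 32/δ, 1) = 3 − 32/δ` and `Σ r_δ = 0`.
[cite: Apostol1990, Thm. 3.4] [cite: RademacherGrosswald1972, Ch. 4 A, eq. (60)] -/
theorem etaQuotient32_smul_W (r : ℕ → ℤ) (hsum : ∑ t ∈ Nat.divisors 32, r t = 0) (W : SL(2, ℤ))
    (h00 : W 0 0 = 1) (h01 : W 0 1 = 0) (h10 : W 1 0 = 32) (h11 : W 1 1 = 1) (τ : ℍ) :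
    etaQuotient 32 r (W • τ)
      = cexp (-(π * I / 12 * ((∑ t ∈ Nat.divisors 32, ((32 / t : ℕ) : ℤ) * r t : ℤ) : ℂ))) * etaQuotient 32 r τ := by
  have h := etaQuotient_smul_eq_cexp_sum_rademacherPhi 32 r hsum W (by rw [h10]; norm_num) (by rw [h10]; norm_num) τ
  rw [h, h00, h01, h10, h11]
  congr 2
  obtain ⟨p1, p2, p4, p8, p16, p32⟩ := rademacherPhi_lower_values32
  rw [show Nat.divisors 32 = {1, 2, 4, 8, 16, 32} by decide]
  rw [Finset.sum_insert (by decide), Finset.sum_insert (by decide), Finset.sum_insert (by decide),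
    Finset.sum_insert (by decide), Finset.sum_insert (by decide), Finset.sum_singleton,
    Finset.sum_insert (by decide), Finset.sum_insert (by decide), Finset.sum_insert (by decide),
    Finset.sum_insert (by decide), Finset.sum_insert (by decide), Finset.sum_singleton]
  simp only [zero_mul]
  norm_num
  rw [p1, p2, p4, p8, p16, p32]
  push_cast
  ring

/-- **`u∘W = −u`** for `u = φ₆₄/φ₃₂ = η₈⁶/(η₄⁴η₁₆²)` (weight `0`, level `32`, log period `½` along `W = (1 0; 32 1)`:
`Σ(32/δ)r_δ = −32 + 24 − 4 = −12`). [cite: Apostol1990, Thm. 3.4] -/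
theorem u_smul_W (W : SL(2, ℤ)) (h00 : W 0 0 = 1) (h01 : W 0 1 = 0) (h10 : W 1 0 = 32) (h11 : W 1 1 = 1) (τ : ℍ) :
    etaQuotient 32 (expFn [(4, -4), (8, 6), (16, -2)]) (W • τ)
      = -etaQuotient 32 (expFn [(4, -4), (8, 6), (16, -2)]) τ := by
  rw [etaQuotient32_smul_W _ (by decide) W h00 h01 h10 h11 τ]
  have hs : (∑ t ∈ Nat.divisors 32, ((32 / t : ℕ) : ℤ) * expFn [(4, -4), (8, 6), (16, -2)] t : ℤ) = -12 := by decide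
  rw [hs, show (-(π * I / 12 * ((-12 : ℤ) : ℂ)) : ℂ) = π * I by push_cast; ring, Complex.exp_pi_mul_I]
  ring

/-- **`u = η₈⁶/(η₄⁴η₁₆²) = E₈⁶/(E₄⁴E₁₆²)`** (weight `0`, order `0` at `∞`). [folklore] -/
theorem u_eq (τ : ℍ) :
    etaQuotient 32 (expFn [(4, -4), (8, 6), (16, -2)]) τ = eulerFn 8 τ ^ 6 / (eulerFn 4 τ ^ 4 * eulerFn 16 τ ^ 2) := by
  have hE4 := eulerFn_ne_zero (by norm_num : 0 < 4) τ
  have hE16 := eulerFn_ne_zero (by norm_num : 0 < 16) τ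
  rw [etaQuotient_eq_cexp_mul_prod, show Nat.divisors 32 = {1, 2, 4, 8, 16, 32} by decide]
  have hsum : (∑ δ ∈ ({1, 2, 4, 8, 16, 32} : Finset ℕ), (δ : ℤ) * expFn [(4, -4), (8, 6), (16, -2)] δ) = 0 := by decide
  rw [hsum, Int.cast_zero, mul_zero, Complex.exp_zero, one_mul]
  rw [Finset.prod_insert (by decide), Finset.prod_insert (by decide), Finset.prod_insert (by decide),
    Finset.prod_insert (by decide), Finset.prod_insert (by decide), Finset.prod_singleton]
  rw [show expFn [(4, -4), (8, 6), (16, -2)] 1 = 0 by decide,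
    show expFn [(4, -4), (8, 6), (16, -2)] 2 = 0 by decide,
    show expFn [(4, -4), (8, 6), (16, -2)] 4 = -4 by decide,
    show expFn [(4, -4), (8, 6), (16, -2)] 8 = 6 by decide,
    show expFn [(4, -4), (8, 6), (16, -2)] 16 = -2 by decide,
    show expFn [(4, -4), (8, 6), (16, -2)] 32 = 0 by decide]
  simp only [zpow_neg, zpow_ofNat]
  field_simp

/-- **`φ₆₄ = u · φ₃₂`** pointwise (`qE₈⁸/(E₄²E₁₆²) = (E₈⁶/(E₄⁴E₁₆²))·(qE₄²E₈²)`). [folklore] -/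
theorem phi64_eq_u_mul_phi32 (τ : ℍ) :
    etaQuotient 64 (expFn [(4, -2), (8, 8), (16, -2)]) τ
      = etaQuotient 32 (expFn [(4, -4), (8, 6), (16, -2)]) τ * cuspFormEtaProductThirtyTwo τ := by
  have hE4 := eulerFn_ne_zero (by norm_num : 0 < 4) τ
  have hE16 := eulerFn_ne_zero (by norm_num : 0 < 16) τ
  rw [phi64_eq, u_eq, etaProductThirtyTwo_eq]
  field_simp

/-- `W = (1 0; 32 1)` lies in `Γ₀(32)`. [folklore] -/
theorem mem_Gamma0_thirtyTwo_of_entries (W : SL(2, ℤ)) (h10 : W 1 0 = 32) : W ∈ Gamma0 32 := by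
  rw [Gamma0_mem, h10]
  decide

/-- **`φ₆₄(Wτ) = −(32τ + 1)² φ₆₄(τ)`** for `W = (1 0; 32 1) ∈ Γ₀(32) ∖ Γ₀(64)` (`u∘W = −u`, `φ₃₂|W = φ₃₂`). [cite: Apostol1990, Thm. 3.4] -/
theorem phi64_smul_W (W : SL(2, ℤ)) (h00 : W 0 0 = 1) (h01 : W 0 1 = 0) (h10 : W 1 0 = 32) (h11 : W 1 1 = 1)
    (τ : ℍ) :
    etaQuotient 64 (expFn [(4, -2), (8, 8), (16, -2)]) (W • τ)
      = -((32 * (τ : ℂ) + 1) ^ 2 * etaQuotient 64 (expFn [(4, -2), (8, 8), (16, -2)]) τ) := by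
  have hf : cuspFormEtaProductThirtyTwo (W • τ) = (32 * (τ : ℂ) + 1) ^ 2 * cuspFormEtaProductThirtyTwo τ := by
    have h := SlashInvariantForm.slash_action_eqn cuspFormEtaProductThirtyTwo _
      ⟨W, mem_Gamma0_thirtyTwo_of_entries W h10, rfl⟩
    have h' := congr_fun h τ
    rw [slash_mapGL, SL_slash_apply, ModularGroup.denom_apply, h10, h11] at h'
    push_cast at h'
    have hne : (32 * (τ : ℂ) + 1) ≠ 0 := by
      have h2 := SL2_denom_ne_zero W τ
      rw [h10, h11] at h2
      push_cast at h2
      exact h2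
    rw [← h']
    field_simp
  rw [phi64_eq_u_mul_phi32, phi64_eq_u_mul_phi32, u_smul_W W h00 h01 h10 h11, hf]
  ring

/-- **`φ₆₄|₂W = −φ₆₄`.** [cite: Apostol1990, Thm. 3.4] -/
theorem phi64_slash_W (W : SL(2, ℤ)) (h00 : W 0 0 = 1) (h01 : W 0 1 = 0) (h10 : W 1 0 = 32) (h11 : W 1 1 = 1)
    (τ : ℍ) :
    (etaQuotient 64 (expFn [(4, -2), (8, 8), (16, -2)]) ∣[(2 : ℤ)] W) τ
      = -etaQuotient 64 (expFn [(4, -2), (8, 8), (16, -2)]) τ := by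
  rw [SL_slash_apply, ModularGroup.denom_apply, h10, h11, phi64_smul_W W h00 h01 h10 h11]
  push_cast
  have hne : (32 * (τ : ℂ) + 1) ≠ 0 := by
    have h2 := SL2_denom_ne_zero W τ
    rw [h10, h11] at h2
    push_cast at h2
    exact h2
  field_simp

/-- **The trace `S₂(Γ₀(64)) → S₂(Γ₀(32))` kills `φ₆₄`**: `adjDegeneracyMap0 64 32 1 2 φ₆₄ = φ₆₄ + φ₆₄|W = 0`, `W = ᵀ(T³²)`.
[cite: DiamondShurman2005, §5.1 special case (3)] -/
theorem adjDegeneracyMap0_one_phi64 (φ : CuspForm (Gamma0 64) 2)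
    (hφ : ⇑φ = etaQuotient 64 (expFn [(4, -2), (8, 8), (16, -2)])) :
    adjDegeneracyMap0 64 32 1 2 φ = 0 := by
  haveI : Fact (Nat.Prime 2) := ⟨Nat.prime_two⟩
  have h := coe_adjDegeneracyMap0_one_eq_sum 2 2 32 64 (by norm_num) (by norm_num) φ
  apply DFunLike.ext
  intro τ
  have hτ := congr_fun h τ
  rw [Finset.sum_apply, Fin.sum_univ_two] at hτ
  rw [CuspForm.zero_apply, hτ]
  have h0 : (Matrix.SpecialLinearGroup.transpose (ModularGroup.T ^ ((32 : ℕ) * (((0 : Fin 2) : ℕ) : ℤ) : ℤ))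
      : SL(2, ℤ)) = 1 := by
    ext i j
    fin_cases i <;> fin_cases j <;>
      simp [Matrix.SpecialLinearGroup.transpose]
  set X : SL(2, ℤ) := Matrix.SpecialLinearGroup.transpose (ModularGroup.T ^ ((32 : ℕ) * (((1 : Fin 2) : ℕ) : ℤ) : ℤ))
    with hX
  have hX' : ∀ i j : Fin 2, X i j = !![(1 : ℤ), 0; 32, 1] i j := by
    intro i j
    rw [hX]
    fin_cases i <;> fin_cases j <;>
      simp [Matrix.SpecialLinearGroup.transpose, ModularGroup.coe_T_zpow]
  rw [h0, map_one, SlashAction.slash_one, slash_mapGL, hφ,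
    phi64_slash_W X (by simpa using hX' 0 0) (by simpa using hX' 0 1) (by simpa using hX' 1 0)
      (by simpa using hX' 1 1)]
  ring

end Summit.BirchSwinnertonDyer.BirchSwinnertonDyer.Theorems.ManinLocalTwoThree.NewformSixtyFour

end
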